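import Literature.MathematicalPhysics.QuantumFieldTheory.OSSkeletonClusters
import HarnessLib

/-!
# The skeleton functional of the Schwinger functions and its one-gap slot structure

Topic `Literature/MathematicalPhysics/QuantumFieldTheory`; second file of the bookkeeping for the
analytic continuation of the Schwinger functions in several time variables along
Osterwalder–Schrader II (Comm. Math. Phys. 42 (1975)), Ch. V, Method A (p. 290) — here the
**slot structure** to which the flat tube theorem
(`Literature.Analysis.Complex.exists_holomorphic_extension_l1Tube`) is applied in the sequel.

Fix a Schwinger family `𝔖` with E1–E2, `k + 2` one-point test functions `φⱼ` with time
supports in `{|y⁰| ≤ r}`, and a separation `w' > 2r`. For gaps `t = (t₀, …, t_k)` the **skeleton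
Schwinger function** is

  `𝒮(t) = 𝔖_{k+2}(⊗ⱼ φⱼ(· - aⱼ(t) e₀))`,  `aⱼ(t) = ∑_{i<j} tᵢ`  (`skelS`),

a continuous, polynomially bounded function of `t` (`continuous_skelS`, `exists_norm_skelS_le`).
**Slot `i`.** Freeze the other gaps `t' ∈ ℝᵏ` at values `≥ 0` and let the gap `i` be
`u ≥ w'`. Then (`skelS_update_eq_genPairing`)

  `𝒮(t'[i ↦ u]) = 𝔖(ΘPᵢ(t')* ⊗ (Rᵢ(t'))_{u - w'}) = ⟪v(Pᵢ(t')), e^{-(u-w')H} v(Rᵢ(t'))⟫`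

with positive-time generators `Pᵢ(t')` (the OS adjoint of the points `0, …, i` recentred at
`-w'/2` below point `i`) and `Rᵢ(t')` (the points `i+1, …, k+1` recentred at `+w'/2`), both
**independent of `u`**, depending continuously on `t'` (`continuous_leftGen`, `continuous_rightGen`)
with norms of polynomial growth (`exists_norm_δ_leftGen_le`, `exists_norm_δ_rightGen_le`). Hence the
slot function extends to the holomorphic function
`τ ↦ ⟪v(Pᵢ(t')), e^{-τH} v(Rᵢ(t'))⟫ = gapContinuation (Pᵢ t') (Rᵢ t') τ` on `{Re τ > 0}`,
bounded by `‖v(Pᵢ(t'))‖ ‖v(Rᵢ(t'))‖` (Osterwalder–Schrader II (5.4): "(5.4) defines an analytic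
continuation of `S_{n+m-1}` in the `n`'th time variable … while still being a distribution in all
the remaining variables" — here the remaining gaps are genuine parameters `t'`).

## References

* K. Osterwalder, R. Schrader, *Axioms for Euclidean Green's functions II*, Comm. Math. Phys.
  42 (1975) 281–305, Ch. V pp. 289–292, (5.3)–(5.4), (5.7). [OsterwalderSchraderCMP1975]
-/

noncomputable section

open MeasureTheory Set Filter
open _root_.Topology
open scoped InnerProductSpace NNReal ComplexConjugate SchwartzMap

namespace Literature.MathematicalPhysics.QuantumFieldTheory

variable {d : ℕ} [NeZero d]

open Literature.MathematicalPhysics.QuantumLattice (SchwingerFamily IsPositiveTimeMulti)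
open Literature.MathematicalPhysics.QuantumLattice.SchwingerFamily
open Literature.MathematicalPhysics.QuantumLattice.SchwingerFamily.OSSpace

/-! ### Skeleton times from gaps -/

/-- The **skeleton times** of the gaps `t`: `aⱼ(t) = ∑_{i < j} tᵢ` (`a₀ = 0`). [folklore] -/
def gapTimes {k : ℕ} (t : Fin (k + 1) → ℝ) (j : Fin (k + 2)) : ℝ :=
  ∑ i ∈ Finset.univ.filter (fun i : Fin (k + 1) => i.val < j.val), t i

/-- `gapTimes` is continuous (linear). [folklore] -/
theorem continuous_gapTimes {k : ℕ} : Continuous (gapTimes (k := k)) :=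
  continuous_pi fun _ => continuous_finsetSum _ fun i _ => continuous_apply i

/-- `|aⱼ(t)| ≤ (k + 1) ‖t‖`. [folklore] -/
theorem abs_gapTimes_le {k : ℕ} (t : Fin (k + 1) → ℝ) (j : Fin (k + 2)) :
    |gapTimes t j| ≤ (k + 1) * ‖t‖ := by
  unfold gapTimes
  refine (Finset.abs_sum_le_sum_abs _ _).trans ?_
  calc ∑ i ∈ Finset.univ.filter (fun i : Fin (k + 1) => i.val < j.val), |t i|
      ≤ ∑ _i : Fin (k + 1), ‖t‖ := by
        refine (Finset.sum_le_sum_of_subset_of_nonneg (Finset.filter_subset _ _)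
          fun i _ _ => abs_nonneg _).trans (Finset.sum_le_sum fun i _ => ?_)
        rw [← Real.norm_eq_abs]
        exact norm_le_pi_norm t i
    _ = (k + 1) * ‖t‖ := by simp

/-- `‖a(t)‖ ≤ (k + 1) ‖t‖`. [folklore] -/
theorem norm_gapTimes_le {k : ℕ} (t : Fin (k + 1) → ℝ) : ‖gapTimes t‖ ≤ (k + 1) * ‖t‖ :=
  (pi_norm_le_iff_of_nonneg (by positivity)).2 fun j => by
    rw [Real.norm_eq_abs]; exact abs_gapTimes_le t j

/-- **Skeleton times before the gap `i` do not see the value of the gap `i`.** [folklore] -/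
theorem gapTimes_update_of_le {k : ℕ} (t : Fin (k + 1) → ℝ) (i : Fin (k + 1)) (u : ℝ)
    {j : Fin (k + 2)} (hj : j.val ≤ i.val) :
    gapTimes (Function.update t i u) j = gapTimes t j := by
  unfold gapTimes
  refine Finset.sum_congr rfl fun i' hi' => ?_
  rw [Finset.mem_filter] at hi'
  have hne : i' ≠ i := fun h => by rw [h] at hi'; omega
  rw [Function.update_of_ne hne]

/-- **Skeleton times after the gap `i` are shifted by the change of the gap `i`.** [folklore] -/
theorem gapTimes_update_of_lt {k : ℕ} (t : Fin (k + 1) → ℝ) (i : Fin (k + 1)) (u : ℝ)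
    {j : Fin (k + 2)} (hj : i.val < j.val) :
    gapTimes (Function.update t i u) j = gapTimes t j - t i + u := by
  unfold gapTimes
  have hi : i ∈ Finset.univ.filter (fun i' : Fin (k + 1) => i'.val < j.val) :=
    Finset.mem_filter.2 ⟨Finset.mem_univ _, hj⟩
  rw [← Finset.add_sum_erase _ _ hi, ← Finset.add_sum_erase _ _ hi, Function.update_self]
  have hrest : ∑ x ∈ (Finset.univ.filter (fun i' : Fin (k + 1) => i'.val < j.val)).erase i,
      Function.update t i u x =
      ∑ x ∈ (Finset.univ.filter (fun i' : Fin (k + 1) => i'.val < j.val)).erase i, t x :=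
    Finset.sum_congr rfl fun x hx => by rw [Function.update_of_ne (Finset.ne_of_mem_erase hx)]
  rw [hrest]
  ring

/-- Differences of skeleton times across the gap `i`: for `j ≤ i < j'`,
`a_{j'}(t) - a_j(t) ≥ tᵢ` when all gaps are nonnegative. [folklore] -/
theorem gapTimes_sub_ge {k : ℕ} {t : Fin (k + 1) → ℝ} (ht : ∀ i, 0 ≤ t i) (i : Fin (k + 1))
    {j j' : Fin (k + 2)} (hj : j.val ≤ i.val) (hj' : i.val < j'.val) :
    t i ≤ gapTimes t j' - gapTimes t j := by
  unfold gapTimes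
  have hsub : Finset.univ.filter (fun i' : Fin (k + 1) => i'.val < j.val) ⊆
      Finset.univ.filter (fun i' : Fin (k + 1) => i'.val < j'.val) := by
    intro x hx
    rw [Finset.mem_filter] at hx ⊢
    exact ⟨hx.1, by omega⟩
  rw [← Finset.sum_sdiff hsub, add_sub_cancel_right]
  have hi : i ∈ Finset.univ.filter (fun i' : Fin (k + 1) => i'.val < j'.val) \
      Finset.univ.filter (fun i' : Fin (k + 1) => i'.val < j.val) := by
    rw [Finset.mem_sdiff, Finset.mem_filter, Finset.mem_filter]
    exact ⟨⟨Finset.mem_univ _, hj'⟩, fun h => by omega⟩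
  rw [← Finset.add_sum_erase _ _ hi]
  have h0 : 0 ≤ ∑ x ∈ (Finset.univ.filter (fun i' : Fin (k + 1) => i'.val < j'.val) \
      Finset.univ.filter (fun i' : Fin (k + 1) => i'.val < j.val)).erase i, t x :=
    Finset.sum_nonneg fun x _ => ht x
  linarith

/-- Skeleton times are monotone in the point index when all gaps are nonnegative. [folklore] -/
theorem gapTimes_mono {k : ℕ} {t : Fin (k + 1) → ℝ} (ht : ∀ i, 0 ≤ t i) {j j' : Fin (k + 2)}
    (hjj' : j.val ≤ j'.val) : gapTimes t j ≤ gapTimes t j' := by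
  unfold gapTimes
  refine Finset.sum_le_sum_of_subset_of_nonneg (fun x hx => ?_) fun x _ _ => ht x
  rw [Finset.mem_filter] at hx ⊢
  exact ⟨hx.1, by omega⟩

/-! ### The skeleton Schwinger function -/

section Skel

variable (𝔖 : SchwingerFamily (EuclideanSpace ℝ (Fin d))) {k : ℕ}
  (φ : Fin (k + 2) → 𝓢(EuclideanSpace ℝ (Fin d), ℂ))

/-- The **skeleton Schwinger function** `𝒮(t) = 𝔖_{k+2}(⊗ⱼ φⱼ(· - aⱼ(t)e₀))`. [cite: OsterwalderSchraderCMP1975, Ch. V p. 290 (Method A)] -/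
def skelS (t : Fin (k + 1) → ℝ) : ℂ :=
  𝔖 (k + 2) (skeletonFn (SchwartzMap.tensorFin (k + 2) φ) (gapTimes t))

/-- **Continuity of the skeleton Schwinger function in the gaps.** [folklore] -/
theorem continuous_skelS : Continuous (skelS 𝔖 φ) :=
  (𝔖 (k + 2)).continuous.comp ((continuous_skeletonFn _).comp continuous_gapTimes)

end Skel

/-- **Polynomial bound of `𝔖_K` on skeleton clusters** in the skeleton times (temperedness E0 of
`𝔖_K` and the polynomial growth of the seminorms of translates, `seminorm_skeletonFn_le`). [folklore] -/
theorem exists_norm_schwinger_skeletonFn_le (𝔖 : SchwingerFamily (EuclideanSpace ℝ (Fin d))) {K : ℕ}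
    (Φ₀ : 𝓢((Fin K → EuclideanSpace ℝ (Fin d)), ℂ)) :
    ∃ (C : ℝ) (N : ℕ), 0 ≤ C ∧ ∀ a : Fin K → ℝ, ‖𝔖 K (skeletonFn Φ₀ a)‖ ≤ C * (1 + ‖a‖) ^ N := by
  obtain ⟨s, C₀, hS⟩ := exists_bound_holds 𝔖 K
  set M : ℝ := (Finset.Iic (s, s)).sup' ⟨(s, s), Finset.mem_Iic.2 le_rfl⟩ fun q =>
    SchwartzMap.seminorm ℂ q.1 q.2 Φ₀ + SchwartzMap.seminorm ℂ 0 q.2 Φ₀ with hM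
  have hM0 : 0 ≤ M := by
    rw [hM]
    exact le_trans (by positivity) (Finset.le_sup' (fun q : ℕ × ℕ =>
      SchwartzMap.seminorm ℂ q.1 q.2 Φ₀ + SchwartzMap.seminorm ℂ 0 q.2 Φ₀) (Finset.mem_Iic.2 le_rfl))
  have hnorm : ∀ a : Fin K → ℝ,
      QuantumLattice.schwartzNorm s (skeletonFn Φ₀ a) ≤ 2 ^ s * (1 + ‖a‖) ^ s * M := by
    intro a
    unfold QuantumLattice.schwartzNorm
    refine Seminorm.finset_sup_apply_le (by positivity) fun q hq => ?_
    rw [Finset.mem_Iic] at hq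
    rw [SchwartzMap.schwartzSeminormFamily_apply]
    refine (seminorm_skeletonFn_le Φ₀ q.1 q.2 a).trans ?_
    have h1 : (2 : ℝ) ^ q.1 ≤ 2 ^ s := pow_le_pow_right₀ (by norm_num) hq.1
    have h2 : (1 + ‖a‖) ^ q.1 ≤ (1 + ‖a‖) ^ s :=
      pow_le_pow_right₀ (by linarith [norm_nonneg a]) hq.1
    have h3 : SchwartzMap.seminorm ℂ q.1 q.2 Φ₀ + SchwartzMap.seminorm ℂ 0 q.2 Φ₀ ≤ M :=
      Finset.le_sup' (fun q : ℕ × ℕ => SchwartzMap.seminorm ℂ q.1 q.2 Φ₀ + SchwartzMap.seminorm ℂ 0 q.2 Φ₀)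
        (Finset.mem_Iic.2 hq)
    have h4 : 0 ≤ SchwartzMap.seminorm ℂ q.1 q.2 Φ₀ + SchwartzMap.seminorm ℂ 0 q.2 Φ₀ := by positivity
    gcongr
  refine ⟨|C₀| * (2 ^ s * M), s, by positivity, fun a => ?_⟩
  refine (hS _).trans ?_
  have hC : C₀ * QuantumLattice.schwartzNorm s (skeletonFn Φ₀ a) ≤
      |C₀| * QuantumLattice.schwartzNorm s (skeletonFn Φ₀ a) :=
    mul_le_mul_of_nonneg_right (le_abs_self _) (QuantumLattice.schwartzNorm_nonneg _ _)
  refine hC.trans ?_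
  rw [mul_assoc, mul_assoc]
  refine mul_le_mul_of_nonneg_left ?_ (abs_nonneg _)
  refine (hnorm _).trans (le_of_eq ?_)
  ring

section Skel

variable (𝔖 : SchwingerFamily (EuclideanSpace ℝ (Fin d))) {k : ℕ}
  (φ : Fin (k + 2) → 𝓢(EuclideanSpace ℝ (Fin d), ℂ))

/-- **Polynomial bound of the skeleton Schwinger function** in the gaps. [folklore] -/
theorem exists_norm_skelS_le :
    ∃ (C : ℝ) (N : ℕ), 0 ≤ C ∧ ∀ t, ‖skelS 𝔖 φ t‖ ≤ C * (1 + ‖t‖) ^ N := by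
  obtain ⟨C, N, hC, hb⟩ := exists_norm_schwinger_skeletonFn_le 𝔖 (SchwartzMap.tensorFin (k + 2) φ)
  refine ⟨C * ((k : ℝ) + 1) ^ N, N, by positivity, fun t => ?_⟩
  refine (hb (gapTimes t)).trans ?_
  have hg : 1 + ‖gapTimes t‖ ≤ ((k : ℝ) + 1) * (1 + ‖t‖) := by
    have := norm_gapTimes_le t
    nlinarith [norm_nonneg t, (Nat.cast_nonneg k : (0 : ℝ) ≤ k)]
  calc C * (1 + ‖gapTimes t‖) ^ N ≤ C * (((k : ℝ) + 1) * (1 + ‖t‖)) ^ N := by gcongr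
    _ = C * ((k : ℝ) + 1) ^ N * (1 + ‖t‖) ^ N := by rw [mul_pow]; ring

/-- **Translation invariance of the skeleton Schwinger function in the skeleton times** (E1):
adding a constant to all skeleton times does not change `𝔖_K`. [folklore] -/
theorem schwinger_skeletonFn_add_const (hE1 : 𝔖.IsEuclideanCovariant) {K : ℕ}
    (Φ₀ : 𝓢((Fin K → EuclideanSpace ℝ (Fin d)), ℂ)) (a : Fin K → ℝ) (c : ℝ) :
    𝔖 K (skeletonFn Φ₀ fun j => a j + c) = 𝔖 K (skeletonFn Φ₀ a) := by
  rw [← translateMulti_skeletonFn, hE1.translateMulti]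

end Skel

/-! ### The slot `i`: splitting, the left and right generators -/

section Slot

variable {k : ℕ} (φ : Fin (k + 2) → 𝓢(EuclideanSpace ℝ (Fin d), ℂ)) (i : Fin (k + 1)) (w' : ℝ)

/-- The number of points left of the gap `i` (points `0, …, i`). [folklore] -/
abbrev nL (i : Fin (k + 1)) : ℕ := i.val + 1

/-- The number of points right of the gap `i` (points `i+1, …, k+1`). [folklore] -/
abbrev nR (i : Fin (k + 1)) : ℕ := k + 1 - i.val

/-- `nL i + nR i = k + 2`. [folklore] -/
theorem nL_add_nR : nL i + nR i = k + 2 := by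
  simp only [nL, nR]; omega

/-- The **recentred skeleton times** for the slot `i`: `aⱼ(t) - aᵢ(t) - w'/2` (point `i` moved to
`-w'/2`). [folklore] -/
def shTimes (t : Fin (k + 1) → ℝ) (j : Fin (k + 2)) : ℝ := gapTimes t j - gapTimes t i.castSucc - w' / 2

/-- The gap vector with the gap `i` set to `w'` and the other gaps `|t'ⱼ|` (absolute values, so
that the generators below are positive-time for *all* `t'`; on the orthant `t' ≥ 0`, which is all
that matters, nothing changes). [folklore] -/
def baseVec (t' : Fin k → ℝ) : Fin (k + 1) → ℝ := i.insertNth w' fun j => |t' j|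

/-- The relabelled profiles along `nL i + nR i = k + 2`. [folklore] -/
def φcast (j : Fin (nL i + nR i)) : 𝓢(EuclideanSpace ℝ (Fin d), ℂ) := φ (Fin.cast (nL_add_nR i) j)

/-- The **left generator of the slot `i`** at the other gaps `t'`. [folklore] -/
def leftGen (t' : Fin k → ℝ) : 𝓢((Fin (nL i) → EuclideanSpace ℝ (Fin d)), ℂ) :=
  leftGenFn (φcast φ i) fun j => shTimes i w' (baseVec i w' t') (Fin.cast (nL_add_nR i) j)

/-- The **right generator of the slot `i`** at the other gaps `t'`. [folklore] -/
def rightGen (t' : Fin k → ℝ) : 𝓢((Fin (nR i) → EuclideanSpace ℝ (Fin d)), ℂ) :=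
  rightGenFn (φcast φ i) (fun j => shTimes i w' (baseVec i w' t') (Fin.cast (nL_add_nR i) j)) 0

variable {φ i w'}

/-- `baseVec` with the gap `i` overwritten is `insertNth`. [folklore] -/
theorem update_baseVec (t' : Fin k → ℝ) (u : ℝ) :
    Function.update (baseVec i w' t') i u = i.insertNth u fun j => |t' j| := by
  rw [baseVec, Fin.update_insertNth]

/-- The gaps of `baseVec` are nonnegative when `w' ≥ 0`. [folklore] -/
theorem baseVec_nonneg (hw0 : 0 ≤ w') (t' : Fin k → ℝ) (i' : Fin (k + 1)) : 0 ≤ baseVec i w' t' i' := by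
  simp only [baseVec]
  refine Fin.succAboveCases i (by simpa using hw0) (fun j' => ?_) i'
  simp

/-- The gap `i` of `baseVec` is `w'`. [folklore] -/
theorem baseVec_apply_same (t' : Fin k → ℝ) : baseVec i w' t' i = w' := by
  rw [baseVec, Fin.insertNth_apply_same]

/-- **The recentred left times do not see the gap `i`.** [folklore] -/
theorem shTimes_update_of_le (t : Fin (k + 1) → ℝ) (u : ℝ) {j : Fin (k + 2)} (hj : j.val ≤ i.val) :
    shTimes i w' (Function.update t i u) j = shTimes i w' t j := by
  simp only [shTimes, gapTimes_update_of_le t i u hj,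
    gapTimes_update_of_le t i u (show (i.castSucc : Fin (k + 2)).val ≤ i.val by simp)]

/-- **The recentred right times are shifted by the change of the gap `i`.** [folklore] -/
theorem shTimes_update_of_lt (t : Fin (k + 1) → ℝ) (u : ℝ) {j : Fin (k + 2)} (hj : i.val < j.val) :
    shTimes i w' (Function.update t i u) j = shTimes i w' t j - t i + u := by
  simp only [shTimes, gapTimes_update_of_lt t i u hj,
    gapTimes_update_of_le t i u (show (i.castSucc : Fin (k + 2)).val ≤ i.val by simp)]
  ring

/-- Left indices stay left of the gap. [folklore] -/
theorem val_cast_castAdd_le (j : Fin (nL i)) :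
    (Fin.cast (nL_add_nR i) (Fin.castAdd (nR i) j) : Fin (k + 2)).val ≤ i.val := by
  have := j.isLt; simp only [nL] at this; simp only [Fin.val_cast, Fin.val_castAdd]; omega

/-- Right indices stay right of the gap. [folklore] -/
theorem lt_val_cast_natAdd (j : Fin (nR i)) :
    i.val < (Fin.cast (nL_add_nR i) (Fin.natAdd (nL i) j) : Fin (k + 2)).val := by
  simp only [Fin.val_cast, Fin.val_natAdd, nL]; omega

/-- **The left generator at gap value `u` is the left generator of the slot.** [folklore] -/
theorem leftGenFn_insertNth (t' : Fin k → ℝ) (u : ℝ) :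
    leftGenFn (φcast φ i) (fun j => shTimes i w' (i.insertNth u fun j => |t' j|) (Fin.cast (nL_add_nR i) j)) =
      leftGen φ i w' t' := by
  rw [leftGen, ← update_baseVec (w' := w') t' u]
  unfold leftGenFn
  congr 2
  funext j
  exact shTimes_update_of_le _ _ (val_cast_castAdd_le j)

/-- **The right generator at gap value `u`, pulled back by `u - w'`, is the right generator of the
slot.** [folklore] -/
theorem rightGenFn_insertNth (t' : Fin k → ℝ) (u : ℝ) :
    rightGenFn (φcast φ i) (fun j => shTimes i w' (i.insertNth u fun j => |t' j|) (Fin.cast (nL_add_nR i) j))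
      (u - w') = rightGen φ i w' t' := by
  rw [rightGen, ← update_baseVec (w' := w') t' u]
  unfold rightGenFn
  congr 1
  funext j
  show shTimes i w' (Function.update (baseVec i w' t') i u) (Fin.cast _ (Fin.natAdd (nL i) j)) - (u - w') =
    shTimes i w' (baseVec i w' t') (Fin.cast _ (Fin.natAdd (nL i) j)) - 0
  rw [shTimes_update_of_lt _ _ (lt_val_cast_natAdd j), baseVec_apply_same]
  ring

/-- `mkGen` only depends on the test function. [folklore] -/
theorem genPairing_mkGen_congr (𝔖 : SchwingerFamily (EuclideanSpace ℝ (Fin d))) {n m : ℕ}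
    {F F' : 𝓢((Fin n → EuclideanSpace ℝ (Fin d)), ℂ)} (hFF' : F = F') (hF : IsPositiveTimeMulti F)
    (hF' : IsPositiveTimeMulti F') {G G' : 𝓢((Fin m → EuclideanSpace ℝ (Fin d)), ℂ)} (hGG' : G = G')
    (hG : IsPositiveTimeMulti G) (hG' : IsPositiveTimeMulti G') (s : ℝ) :
    genPairing 𝔖 (mkGen F hF) (shiftGen s (mkGen G hG)) = genPairing 𝔖 (mkGen F' hF') (shiftGen s (mkGen G' hG')) := by
  subst hFF' hGG'
  rfl

variable {r : ℝ}

/-- With nonnegative gaps and the gap `i` at least `w'`, the recentred left times are `< -r`. [folklore] -/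
theorem shTimes_left_lt (hw : 2 * r < w') {t : Fin (k + 1) → ℝ} (ht : ∀ i', 0 ≤ t i') (j : Fin (nL i)) :
    shTimes i w' t (Fin.cast (nL_add_nR i) (Fin.castAdd (nR i) j)) < -r := by
  simp only [shTimes]
  have hmono := gapTimes_mono ht (j := Fin.cast (nL_add_nR i) (Fin.castAdd (nR i) j))
    (j' := i.castSucc) (by have := val_cast_castAdd_le (i := i) j; simpa using this)
  linarith

/-- With nonnegative gaps and the gap `i` equal to `u ≥ w'`, the recentred right times are
`> r + (u - w')`. [folklore] -/
theorem shTimes_right_gt (hw : 2 * r < w') {t : Fin (k + 1) → ℝ} (ht : ∀ i', 0 ≤ t i') {u : ℝ}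
    (hu : t i = u) (j : Fin (nR i)) :
    r + (u - w') < shTimes i w' t (Fin.cast (nL_add_nR i) (Fin.natAdd (nL i) j)) := by
  simp only [shTimes]
  have h := gapTimes_sub_ge ht i (j := i.castSucc) (j' := Fin.cast (nL_add_nR i) (Fin.natAdd (nL i) j))
    (by simp) (lt_val_cast_natAdd j)
  linarith

/-- **The left generator of the slot is positive-time.** [folklore] -/
theorem isPositiveTimeMulti_leftGen (hφ : ∀ j, tsupport (φ j : EuclideanSpace ℝ (Fin d) → ℂ) ⊆ {y | |y 0| ≤ r})
    (hw : 2 * r < w') (hw0 : 0 ≤ w') (t' : Fin k → ℝ) :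
    IsPositiveTimeMulti (leftGen φ i w' t') :=
  isPositiveTimeMulti_leftGenFn (fun _ => hφ _) fun j => shTimes_left_lt hw (baseVec_nonneg hw0 t') j

/-- **The right generator of the slot is positive-time.** [folklore] -/
theorem isPositiveTimeMulti_rightGen (hφ : ∀ j, tsupport (φ j : EuclideanSpace ℝ (Fin d) → ℂ) ⊆ {y | |y 0| ≤ r})
    (hw : 2 * r < w') (hw0 : 0 ≤ w') (t' : Fin k → ℝ) :
    IsPositiveTimeMulti (rightGen φ i w' t') := by
  refine isPositiveTimeMulti_rightGenFn (fun _ => hφ _) fun j => ?_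
  have h := shTimes_right_gt hw (baseVec_nonneg hw0 t') (baseVec_apply_same t') j
  simpa using h

/-- **The slot identity** (Osterwalder–Schrader II (5.4) for the skeleton functional): with the
other gaps `t' ≥ 0` frozen and the gap `i` equal to `u ≥ w'`,
`𝒮(t'[i ↦ u]) = 𝔖(ΘPᵢ(t')* ⊗ (Rᵢ(t'))_{u - w'}) = genPairing (Pᵢ t') (shiftGen (u - w') (Rᵢ t'))`. [cite: OsterwalderSchraderCMP1975, Ch. V eq. (5.4)] -/
theorem skelS_insertNth_eq_genPairing (𝔖 : SchwingerFamily (EuclideanSpace ℝ (Fin d)))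
    (hE1 : 𝔖.IsEuclideanCovariant)
    (hφ : ∀ j, tsupport (φ j : EuclideanSpace ℝ (Fin d) → ℂ) ⊆ {y | |y 0| ≤ r}) (hr : 0 ≤ r)
    (hw : 2 * r < w') {t' : Fin k → ℝ} (ht' : ∀ i', 0 ≤ t' i') {u : ℝ} (hu : w' ≤ u) :
    skelS 𝔖 φ (i.insertNth u t') =
      genPairing 𝔖 (mkGen (leftGen φ i w' t') (isPositiveTimeMulti_leftGen hφ hw (by linarith) t'))
        (shiftGen (u - w') (mkGen (rightGen φ i w' t')
          (isPositiveTimeMulti_rightGen hφ hw (by linarith) t'))) := by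
  have habs : (fun j => |t' j|) = t' := funext fun j => abs_of_nonneg (ht' j)
  set t : Fin (k + 1) → ℝ := i.insertNth u t' with htdef
  have ht : ∀ i', 0 ≤ t i' := by
    intro i'
    simp only [htdef]
    refine Fin.succAboveCases i (by simp; linarith) (fun j' => ?_) i'
    simpa using ht' j'
  have hti : t i = u := by simp [htdef]
  -- recentre, split, and identify the two generators
  have h1 : skelS 𝔖 φ t = 𝔖 (k + 2) (skeletonFn (SchwartzMap.tensorFin (k + 2) φ) (shTimes i w' t)) := by
    rw [skelS, ← schwinger_skeletonFn_add_const 𝔖 hE1 _ (gapTimes t) (-gapTimes t i.castSucc - w' / 2)]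
    congr 2
    funext j
    simp only [shTimes]
    ring
  rw [h1, schwinger_skeletonFn_eq_genPairing_cast 𝔖 (nL_add_nR i) hφ (t := u - w') (by linarith)
    (fun j => shTimes_left_lt hw ht j) (fun j => shTimes_right_gt hw ht hti j)]
  have hL := leftGenFn_insertNth (φ := φ) (i := i) (w' := w') t' u
  have hR := rightGenFn_insertNth (φ := φ) (i := i) (w' := w') t' u
  rw [habs] at hL hR
  exact genPairing_mkGen_congr 𝔖 hL _ _ hR _ _ _

end Slot



/-! ### Continuity of the generators and of the vectors; norm bounds -/

section Vectors

variable {𝔖 : SchwingerFamily (EuclideanSpace ℝ (Fin d))} (hE2 : 𝔖.IsOSReflectionPositive)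

/-- **Continuity of the OS vector of a continuously varying positive-time test function**:
`x ↦ v(G x) = ι δ_{(n, G x)}` is continuous into the OS Hilbert space when `x ↦ G x` is continuous
into `𝓢`, because `‖v(G) - v(G')‖² = Re[𝔖(ΘG*⊗G) - 2 𝔖(ΘG*⊗G') + 𝔖(ΘG'*⊗G')]` and the OS
pairing is jointly continuous. [folklore] -/
theorem continuous_ι_δ_mkGen {X : Type*} [TopologicalSpace X] {n : ℕ}
    {G : X → 𝓢((Fin n → EuclideanSpace ℝ (Fin d)), ℂ)} (hG : Continuous G)
    (hpos : ∀ x, IsPositiveTimeMulti (G x)) :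
    Continuous fun x => ι 𝔖 hE2 (δ 𝔖 hE2 (mkGen (G x) (hpos x))) := by
  set v : X → OSHilbert 𝔖 hE2 := fun x => ι 𝔖 hE2 (δ 𝔖 hE2 (mkGen (G x) (hpos x))) with hv
  have hinner : ∀ x y, ⟪v x, v y⟫_ℂ = 𝔖.osPairing (G x) (G y) := fun x y => by
    rw [hv]; simp only; rw [inner_ι_ι, inner_δ_δ]; rfl
  refine continuous_iff_continuousAt.2 fun x₀ => ?_
  rw [ContinuousAt, tendsto_iff_norm_sub_tendsto_zero]
  have hsq : ∀ x, ‖v x - v x₀‖ ^ 2 =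
      (𝔖.osPairing (G x) (G x)).re - 2 * (𝔖.osPairing (G x) (G x₀)).re + (𝔖.osPairing (G x₀) (G x₀)).re := by
    intro x
    rw [@norm_sub_sq ℂ, ← @inner_self_eq_norm_sq ℂ, ← @inner_self_eq_norm_sq ℂ, hinner, hinner, hinner]
    rfl
  have hlim : Tendsto (fun x => ‖v x - v x₀‖ ^ 2) (𝓝 x₀) (𝓝 0) := by
    simp_rw [hsq]
    have h1 := (𝔖.tendsto_osPairing (hG.tendsto x₀) (hG.tendsto x₀))
    have h2 := (𝔖.tendsto_osPairing (hG.tendsto x₀) (tendsto_const_nhds (x := G x₀)))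
    have h := ((Complex.continuous_re.tendsto _).comp h1).sub
      ((((Complex.continuous_re.tendsto _).comp h2).const_mul 2)) |>.add
      (tendsto_const_nhds (x := (𝔖.osPairing (G x₀) (G x₀)).re))
    have h0 : (𝔖.osPairing (G x₀) (G x₀)).re - 2 * (𝔖.osPairing (G x₀) (G x₀)).re +
        (𝔖.osPairing (G x₀) (G x₀)).re = 0 := by ring
    rw [h0] at h
    exact h
  have hsqrt : Tendsto (fun x => Real.sqrt (‖v x - v x₀‖ ^ 2)) (𝓝 x₀) (𝓝 0) := by
    have := (Real.continuous_sqrt.tendsto 0).comp hlim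
    rwa [Real.sqrt_zero] at this
  refine hsqrt.congr fun x => ?_
  rw [Real.sqrt_sq (norm_nonneg _)]

/-- **Norm bound of an OS vector through a skeleton**: if `ΘP* ⊗ P` is a skeleton cluster
`skeletonFn Ψ₀ A`, then `‖v(P)‖ ≤ C (1 + ‖A‖)ᴺ` with the constants of
`exists_norm_schwinger_skeletonFn_le` for `Ψ₀` (`‖v(P)‖² = Re 𝔖(ΘP*⊗P)`). [folklore] -/
theorem exists_norm_δ_le_of_skeletonFn (𝔖 : SchwingerFamily (EuclideanSpace ℝ (Fin d)))
    (hE2 : 𝔖.IsOSReflectionPositive) {n : ℕ} (Ψ₀ : 𝓢((Fin (n + n) → EuclideanSpace ℝ (Fin d)), ℂ)) :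
    ∃ (C : ℝ) (N : ℕ), 0 ≤ C ∧ ∀ (P : 𝓢((Fin n → EuclideanSpace ℝ (Fin d)), ℂ)) (hP : IsPositiveTimeMulti P)
      (A : Fin (n + n) → ℝ), (QuantumLattice.osAdjoint P).appendTensor P = skeletonFn Ψ₀ A →
      ‖δ 𝔖 hE2 (mkGen P hP)‖ ≤ C * (1 + ‖A‖) ^ N := by
  obtain ⟨C, N, hC, hb⟩ := exists_norm_schwinger_skeletonFn_le 𝔖 Ψ₀
  refine ⟨1 + C, N, by positivity, fun P hP A hA => ?_⟩
  have hsq : ‖δ 𝔖 hE2 (mkGen P hP)‖ ^ 2 ≤ C * (1 + ‖A‖) ^ N := by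
    rw [norm_δ_sq]
    refine (RCLike.re_le_norm _).trans ?_
    rw [genPairing_eq]
    change ‖𝔖 (n + n) ((QuantumLattice.osAdjoint P).appendTensor P)‖ ≤ _
    rw [hA]
    exact hb A
  have h1 : (1 : ℝ) ≤ (1 + ‖A‖) ^ N := one_le_pow₀ (by linarith [norm_nonneg A])
  nlinarith [norm_nonneg (δ 𝔖 hE2 (mkGen P hP)), hsq, mul_nonneg hC (zero_le_one.trans h1)]

end Vectors

/-! ### The generators of the slot: continuity and skeleton structure of their Gram functions -/

section SlotAnalysis

variable {k : ℕ} (φ : Fin (k + 2) → 𝓢(EuclideanSpace ℝ (Fin d), ℂ)) (i : Fin (k + 1)) (w' : ℝ)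

/-- The recentred base times as a function of the other gaps: continuous. [folklore] -/
theorem continuous_shTimes_baseVec :
    Continuous fun t' : Fin k → ℝ => fun J : Fin (k + 2) => shTimes i w' (baseVec i w' t') J := by
  have hb : Continuous fun t' : Fin k → ℝ => baseVec i w' t' :=
    Continuous.finInsertNth i continuous_const (continuous_pi fun j => (continuous_apply j).abs)
  have hg : Continuous fun t' : Fin k → ℝ => gapTimes (baseVec i w' t') := continuous_gapTimes.comp hb
  refine continuous_pi fun J => ?_
  simp only [shTimes]
  exact (((continuous_apply J).comp hg).sub ((continuous_apply _).comp hg)).sub continuous_const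

/-- **Continuity of the left generator in the other gaps.** [folklore] -/
theorem continuous_leftGen : Continuous (leftGen φ i w') := by
  unfold leftGen leftGenFn
  refine QuantumLattice.continuous_osAdjoint.comp ((continuous_skeletonFn _).comp ?_)
  exact continuous_pi fun j =>
    (continuous_apply (Fin.cast (nL_add_nR i) (Fin.castAdd (nR i) j))).comp (continuous_shTimes_baseVec i w')

/-- **Continuity of the right generator in the other gaps.** [folklore] -/
theorem continuous_rightGen : Continuous (rightGen φ i w') := by
  unfold rightGen rightGenFn
  refine (continuous_skeletonFn _).comp ?_
  exact continuous_pi fun j =>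
    ((continuous_apply (Fin.cast (nL_add_nR i) (Fin.natAdd (nL i) j))).comp
      (continuous_shTimes_baseVec i w')).sub continuous_const

/-- Appending two skeleton tensor clusters gives the skeleton tensor cluster of the appended
profiles and times. [folklore] -/
theorem appendTensor_skeletonFn_tensorFin {n m : ℕ} (ψ : Fin n → 𝓢(EuclideanSpace ℝ (Fin d), ℂ))
    (ψ' : Fin m → 𝓢(EuclideanSpace ℝ (Fin d), ℂ)) (a : Fin n → ℝ) (a' : Fin m → ℝ) :
    (skeletonFn (SchwartzMap.tensorFin n ψ) a).appendTensor (skeletonFn (SchwartzMap.tensorFin m ψ') a') =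
      skeletonFn (SchwartzMap.tensorFin (n + m) (Fin.append ψ ψ')) (Fin.append a a') := by
  rw [skeletonFn_tensorFin_add]
  simp only [Fin.append_left, Fin.append_right]

/-- The norm of an appended real vector is the larger of the two norms. [folklore] -/
theorem norm_append_le {n m : ℕ} (a : Fin n → ℝ) (a' : Fin m → ℝ) :
    ‖Fin.append a a'‖ ≤ max ‖a‖ ‖a'‖ := by
  refine (pi_norm_le_iff_of_nonneg (by positivity)).2 fun J => ?_
  induction J using Fin.addCases with
  | left j => rw [Fin.append_left]; exact (norm_le_pi_norm a j).trans (le_max_left _ _)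
  | right j => rw [Fin.append_right]; exact (norm_le_pi_norm a' j).trans (le_max_right _ _)

/-- **The Gram function of the left generator is a skeleton cluster** of `2 nL` points. [folklore] -/
theorem osAdjoint_appendTensor_leftGen (t' : Fin k → ℝ) :
    (QuantumLattice.osAdjoint (leftGen φ i w' t')).appendTensor (leftGen φ i w' t') =
      skeletonFn (SchwartzMap.tensorFin (nL i + nL i)
        (Fin.append (fun j => φcast φ i (Fin.castAdd (nR i) j))
          fun j => reflectOne (φcast φ i (Fin.castAdd (nR i) (Fin.rev j)))))
        (Fin.append (fun j => shTimes i w' (baseVec i w' t') (Fin.cast (nL_add_nR i) (Fin.castAdd (nR i) j)))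
          fun j => -shTimes i w' (baseVec i w' t') (Fin.cast (nL_add_nR i) (Fin.castAdd (nR i) (Fin.rev j)))) := by
  have h1 : QuantumLattice.osAdjoint (leftGen φ i w' t') =
      skeletonFn (SchwartzMap.tensorFin (nL i) fun j => φcast φ i (Fin.castAdd (nR i) j))
        fun j => shTimes i w' (baseVec i w' t') (Fin.cast (nL_add_nR i) (Fin.castAdd (nR i) j)) := by
    rw [leftGen, leftGenFn, QuantumLattice.osAdjoint_osAdjoint]
  rw [h1]
  conv_lhs => rw [leftGen, leftGenFn_eq]
  rw [appendTensor_skeletonFn_tensorFin]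

/-- **The Gram function of the right generator is a skeleton cluster** of `2 nR` points. [folklore] -/
theorem osAdjoint_appendTensor_rightGen (t' : Fin k → ℝ) :
    (QuantumLattice.osAdjoint (rightGen φ i w' t')).appendTensor (rightGen φ i w' t') =
      skeletonFn (SchwartzMap.tensorFin (nR i + nR i)
        (Fin.append (fun j => reflectOne (φcast φ i (Fin.natAdd (nL i) (Fin.rev j))))
          fun j => φcast φ i (Fin.natAdd (nL i) j)))
        (Fin.append (fun j => -(shTimes i w' (baseVec i w' t') (Fin.cast (nL_add_nR i) (Fin.natAdd (nL i) (Fin.rev j))) - 0))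
          fun j => shTimes i w' (baseVec i w' t') (Fin.cast (nL_add_nR i) (Fin.natAdd (nL i) j)) - 0) := by
  rw [rightGen, rightGenFn, osAdjoint_skeletonFn_tensorFin, appendTensor_skeletonFn_tensorFin]

/-- Affine bound of the recentred base times: `|shTimes| ≤ 2(k+1)(|w'| + ‖t'‖) + |w'|`. [folklore] -/
theorem abs_shTimes_baseVec_le (t' : Fin k → ℝ) (J : Fin (k + 2)) :
    |shTimes i w' (baseVec i w' t') J| ≤ 2 * (k + 1) * (|w'| + ‖t'‖) + |w'| := by
  have hbv : ‖baseVec i w' t'‖ ≤ |w'| + ‖t'‖ := by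
    refine (pi_norm_le_iff_of_nonneg (by positivity)).2 fun i' => ?_
    simp only [baseVec]
    refine Fin.succAboveCases i ?_ (fun j' => ?_) i'
    · simp only [Fin.insertNth_apply_same, Real.norm_eq_abs]
      linarith [norm_nonneg t']
    · simp only [Fin.insertNth_apply_succAbove, Real.norm_eq_abs, abs_abs]
      have := norm_le_pi_norm t' j'
      rw [Real.norm_eq_abs] at this
      linarith [abs_nonneg w']
  have h1 := abs_gapTimes_le (baseVec i w' t') J
  have h2 := abs_gapTimes_le (baseVec i w' t') i.castSucc
  simp only [shTimes]
  have h3 : |gapTimes (baseVec i w' t') J - gapTimes (baseVec i w' t') i.castSucc - w' / 2| ≤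
      |gapTimes (baseVec i w' t') J| + |gapTimes (baseVec i w' t') i.castSucc| + |w' / 2| :=
    (abs_sub _ _).trans (add_le_add (abs_sub _ _) le_rfl)
  have h4 : |w' / 2| ≤ |w'| := by rw [abs_div, abs_two]; linarith [abs_nonneg w']
  have hk : (0 : ℝ) ≤ k + 1 := by positivity
  nlinarith [h1, h2, h3, h4, hbv, mul_le_mul_of_nonneg_left hbv hk]

variable {𝔖 : SchwingerFamily (EuclideanSpace ℝ (Fin d))}

/-- **Polynomial norm bound for the vectors of the left generator.** [folklore] -/
theorem exists_norm_δ_leftGen_le (𝔖 : SchwingerFamily (EuclideanSpace ℝ (Fin d)))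
    (hE2 : 𝔖.IsOSReflectionPositive) :
    ∃ (C : ℝ) (N : ℕ), 0 ≤ C ∧ ∀ (t' : Fin k → ℝ) (hP : IsPositiveTimeMulti (leftGen φ i w' t')),
      ‖δ 𝔖 hE2 (mkGen (leftGen φ i w' t') hP)‖ ≤ C * (1 + ‖t'‖) ^ N := by
  obtain ⟨C, N, hC, hb⟩ := exists_norm_δ_le_of_skeletonFn 𝔖 hE2
    (SchwartzMap.tensorFin (nL i + nL i) (Fin.append (fun j => φcast φ i (Fin.castAdd (nR i) j))
      fun j => reflectOne (φcast φ i (Fin.castAdd (nR i) (Fin.rev j)))))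
  set D : ℝ := 2 * (k + 1) * |w'| + |w'| + 1 with hD
  have hD1 : 1 ≤ D := by rw [hD]; nlinarith [abs_nonneg w', (by positivity : (0 : ℝ) ≤ k + 1)]
  refine ⟨C * (D + 2 * (k + 1)) ^ N, N, by positivity, fun t' hP => ?_⟩
  refine (hb _ hP _ (osAdjoint_appendTensor_leftGen φ i w' t')).trans ?_
  have hA : ‖Fin.append (fun j => shTimes i w' (baseVec i w' t') (Fin.cast (nL_add_nR i) (Fin.castAdd (nR i) j)))
      fun j => -shTimes i w' (baseVec i w' t') (Fin.cast (nL_add_nR i) (Fin.castAdd (nR i) (Fin.rev j)))‖ ≤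
      2 * (k + 1) * (|w'| + ‖t'‖) + |w'| := by
    refine (pi_norm_le_iff_of_nonneg (by positivity)).2 fun J => ?_
    induction J using Fin.addCases with
    | left j => rw [Fin.append_left, Real.norm_eq_abs]; exact abs_shTimes_baseVec_le i w' t' _
    | right j => rw [Fin.append_right, norm_neg, Real.norm_eq_abs]; exact abs_shTimes_baseVec_le i w' t' _
  have hle : 1 + (2 * (k + 1) * (|w'| + ‖t'‖) + |w'|) ≤ (D + 2 * (k + 1)) * (1 + ‖t'‖) := by
    rw [hD]
    nlinarith [norm_nonneg t', abs_nonneg w', (by positivity : (0 : ℝ) ≤ k + 1),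
      mul_nonneg (by positivity : (0 : ℝ) ≤ 2 * (k + 1) * |w'| + |w'| + 1) (norm_nonneg t')]
  calc C * (1 + ‖Fin.append (fun j => shTimes i w' (baseVec i w' t') (Fin.cast (nL_add_nR i) (Fin.castAdd (nR i) j)))
        fun j => -shTimes i w' (baseVec i w' t') (Fin.cast (nL_add_nR i) (Fin.castAdd (nR i) (Fin.rev j)))‖) ^ N
      ≤ C * ((D + 2 * (k + 1)) * (1 + ‖t'‖)) ^ N := by
        gcongr
        exact (add_le_add le_rfl hA).trans hle
    _ = C * (D + 2 * (k + 1)) ^ N * (1 + ‖t'‖) ^ N := by rw [mul_pow]; ring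

/-- **Polynomial norm bound for the vectors of the right generator.** [folklore] -/
theorem exists_norm_δ_rightGen_le (𝔖 : SchwingerFamily (EuclideanSpace ℝ (Fin d)))
    (hE2 : 𝔖.IsOSReflectionPositive) :
    ∃ (C : ℝ) (N : ℕ), 0 ≤ C ∧ ∀ (t' : Fin k → ℝ) (hP : IsPositiveTimeMulti (rightGen φ i w' t')),
      ‖δ 𝔖 hE2 (mkGen (rightGen φ i w' t') hP)‖ ≤ C * (1 + ‖t'‖) ^ N := by
  obtain ⟨C, N, hC, hb⟩ := exists_norm_δ_le_of_skeletonFn 𝔖 hE2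
    (SchwartzMap.tensorFin (nR i + nR i) (Fin.append (fun j => reflectOne (φcast φ i (Fin.natAdd (nL i) (Fin.rev j))))
      fun j => φcast φ i (Fin.natAdd (nL i) j)))
  set D : ℝ := 2 * (k + 1) * |w'| + |w'| + 1 with hD
  refine ⟨C * (D + 2 * (k + 1)) ^ N, N, by positivity, fun t' hP => ?_⟩
  refine (hb _ hP _ (osAdjoint_appendTensor_rightGen φ i w' t')).trans ?_
  have hA : ‖Fin.append (fun j => -(shTimes i w' (baseVec i w' t') (Fin.cast (nL_add_nR i) (Fin.natAdd (nL i) (Fin.rev j))) - 0))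
      fun j => shTimes i w' (baseVec i w' t') (Fin.cast (nL_add_nR i) (Fin.natAdd (nL i) j)) - 0‖ ≤
      2 * (k + 1) * (|w'| + ‖t'‖) + |w'| := by
    refine (pi_norm_le_iff_of_nonneg (by positivity)).2 fun J => ?_
    induction J using Fin.addCases with
    | left j => rw [Fin.append_left, sub_zero, norm_neg, Real.norm_eq_abs]; exact abs_shTimes_baseVec_le i w' t' _
    | right j => rw [Fin.append_right, sub_zero, Real.norm_eq_abs]; exact abs_shTimes_baseVec_le i w' t' _
  have hle : 1 + (2 * (k + 1) * (|w'| + ‖t'‖) + |w'|) ≤ (D + 2 * (k + 1)) * (1 + ‖t'‖) := by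
    rw [hD]
    nlinarith [norm_nonneg t', abs_nonneg w', (by positivity : (0 : ℝ) ≤ k + 1),
      mul_nonneg (by positivity : (0 : ℝ) ≤ 2 * (k + 1) * |w'| + |w'| + 1) (norm_nonneg t')]
  calc C * (1 + ‖Fin.append (fun j => -(shTimes i w' (baseVec i w' t') (Fin.cast (nL_add_nR i) (Fin.natAdd (nL i) (Fin.rev j))) - 0))
        fun j => shTimes i w' (baseVec i w' t') (Fin.cast (nL_add_nR i) (Fin.natAdd (nL i) j)) - 0‖) ^ N
      ≤ C * ((D + 2 * (k + 1)) * (1 + ‖t'‖)) ^ N := by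
        gcongr
        exact (add_le_add le_rfl hA).trans hle
    _ = C * (D + 2 * (k + 1)) ^ N * (1 + ‖t'‖) ^ N := by rw [mul_pow]; ring

end SlotAnalysis

/-! ### The holomorphic slot function -/

section SlotExt

variable (𝔖 : SchwingerFamily (EuclideanSpace ℝ (Fin d))) (hE1 : 𝔖.IsEuclideanCovariant)
  (hE2 : 𝔖.IsOSReflectionPositive) {k : ℕ} (φ : Fin (k + 2) → 𝓢(EuclideanSpace ℝ (Fin d), ℂ))
  (i : Fin (k + 1)) {w' r : ℝ}
  (hφ : ∀ j, tsupport (φ j : EuclideanSpace ℝ (Fin d) → ℂ) ⊆ {y | |y 0| ≤ r}) (hw : 2 * r < w')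
  (hw0 : 0 ≤ w')

/-- The **holomorphic slot function** of the gap `i` at the other gaps `t'`:
`τ ↦ ⟪v(Pᵢ(t')), e^{-τH} v(Rᵢ(t'))⟫ = gapContinuation (Pᵢ t') (Rᵢ t') τ`. [cite: OsterwalderSchraderCMP1975, Ch. V eq. (5.4)] -/
def slotExt (t' : Fin k → ℝ) (τ : ℂ) : ℂ :=
  gapContinuation 𝔖 hE1 hE2 (mkGen (leftGen φ i w' t') (isPositiveTimeMulti_leftGen hφ hw hw0 t'))
    (mkGen (rightGen φ i w' t') (isPositiveTimeMulti_rightGen hφ hw hw0 t')) τ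

/-- **On the real axis the slot function is the skeleton Schwinger function**:
`slotExt t' s = 𝒮(t'[i ↦ w' + s])` for `s ≥ 0` and `t' ≥ 0`. [cite: OsterwalderSchraderCMP1975, Ch. V eqs. (5.3)–(5.4)] -/
theorem slotExt_ofReal (hr : 0 ≤ r) {t' : Fin k → ℝ} (ht' : ∀ i', 0 ≤ t' i') {s : ℝ} (hs : 0 ≤ s) :
    slotExt 𝔖 hE1 hE2 φ i hφ hw hw0 t' s = skelS 𝔖 φ (i.insertNth (w' + s) t') := by
  rw [slotExt, gapContinuation_ofReal _ _ hs,
    skelS_insertNth_eq_genPairing 𝔖 hE1 hφ hr hw ht' (by linarith : w' ≤ w' + s)]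
  congr 2
  ring

/-- **Holomorphy of the slot function** on `{Re τ > 0}`. [cite: OsterwalderSchraderCMP1975, Ch. V eq. (5.4)] -/
theorem differentiableOn_slotExt (t' : Fin k → ℝ) :
    DifferentiableOn ℂ (slotExt 𝔖 hE1 hE2 φ i hφ hw hw0 t') {τ : ℂ | 0 < τ.re} :=
  differentiableOn_gapContinuation _ _

/-- **Continuity of the slot function** on `{Re τ ≥ 0}`. [folklore] -/
theorem continuousOn_slotExt (t' : Fin k → ℝ) :
    ContinuousOn (slotExt 𝔖 hE1 hE2 φ i hφ hw hw0 t') {τ : ℂ | 0 ≤ τ.re} :=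
  continuousOn_gapContinuation _ _

/-- **Polynomial bound of the slot function, uniformly on `{Re τ ≥ 0}`**:
`‖slotExt t' τ‖ ≤ ‖v(Pᵢ t')‖ ‖v(Rᵢ t')‖ ≤ C (1 + ‖t'‖)ᴺ`. [cite: OsterwalderSchraderCMP1975, Ch. V eq. (5.4) and Ch. VI.1] -/
theorem exists_norm_slotExt_le :
    ∃ (C : ℝ) (N : ℕ), 0 ≤ C ∧ ∀ (t' : Fin k → ℝ) (τ : ℂ), 0 ≤ τ.re →
      ‖slotExt 𝔖 hE1 hE2 φ i hφ hw hw0 t' τ‖ ≤ C * (1 + ‖t'‖) ^ N := by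
  obtain ⟨C₁, N₁, hC₁, h₁⟩ := exists_norm_δ_leftGen_le φ i w' 𝔖 hE2
  obtain ⟨C₂, N₂, hC₂, h₂⟩ := exists_norm_δ_rightGen_le φ i w' 𝔖 hE2
  refine ⟨C₁ * C₂, N₁ + N₂, by positivity, fun t' τ hτ => ?_⟩
  refine (norm_gapContinuation_le _ _ hτ).trans ?_
  calc ‖δ 𝔖 hE2 (mkGen (leftGen φ i w' t') _)‖ * ‖δ 𝔖 hE2 (mkGen (rightGen φ i w' t') _)‖
      ≤ (C₁ * (1 + ‖t'‖) ^ N₁) * (C₂ * (1 + ‖t'‖) ^ N₂) :=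
        mul_le_mul (h₁ t' _) (h₂ t' _) (norm_nonneg _) (by positivity)
    _ = C₁ * C₂ * (1 + ‖t'‖) ^ (N₁ + N₂) := by rw [pow_add]; ring

/-- **Continuity of the slot function in the other gaps** at fixed `τ`, `Re τ ≥ 0` (the vectors
depend continuously on `t'`, the holomorphic semigroup is a bounded operator). [folklore] -/
theorem continuous_slotExt_left (τ : ℂ) :
    Continuous fun t' : Fin k → ℝ => slotExt 𝔖 hE1 hE2 φ i hφ hw hw0 t' τ := by
  unfold slotExt gapContinuation
  exact (continuous_ι_δ_mkGen hE2 (continuous_leftGen φ i w') _).inner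
    ((holoShiftH (hE2 := hE2) hE1 τ).continuous.comp
      (continuous_ι_δ_mkGen hE2 (continuous_rightGen φ i w') _))

end SlotExt

end Literature.MathematicalPhysics.QuantumFieldTheory
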